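import Summits.Ventures.Crystal3D.Theorems.StickyWulffConstantGenericWallFloorBarlowCoreAvoid
import Summits.Ventures.Crystal3D.Theorems.StickyWulffConstantGenericWallFloorStackWalkInjectiveTiltWide
import HarnessLib

/-!
# Core avoidance with a WIDE tilted vertical (‖z − e‖ ≤ 1/3, `e = ±e₃`, TILT CONSTANT OF RECORD cf-p1 (cv)(ii)): apart steered Barlow families end in
# the payer window (K1b / EDGE-ON option (ε), WIDE brick 3; lane T crux `TextureLiminfV5`, stmt-Ventures-23912, sub-crux EDGE-ON `stub_edgeOn`; HOME/wall-p2-g11/EPSILON-SIZING.md)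

HONEST FRAMING. Venture `Summits/Ventures/Crystal3D` (cell `crystal3d-full`), route `route-Ventures-StickyWulffConstant`, helper `--supports` the
law-v5 crux `TextureLiminfV5` (stmt-Ventures-23912), registered line `TexShadow` v8.3, open stub `stub_edgeOn` (K4).  Rung credit only; F-C1 not moved; NOT
the stub.  Pure walk bookkeeping, standard axioms; E1 BY NAME (`hs₀/hcert`).

THE POINT.  `…BarlowCoreAvoid` (p66…, K1a) shows that a walker of a Barlow family whose chain frames are apart from the far plate's two lattices ends in lane T's
payer window — for the wall-normal steering `z = e₃` (plate 1) / `−e₃` (plate 2): the end lemma `stackWalk_end` bounds the fuel and the drift by `z`-HEIGHTS of the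
cell.  `…BarlowCoreAvoidTilt` (p696920) is the ‖z − e‖ ≤ 1/4 form; this is the 1/3 form on `…StackWalkInjectiveTiltWide` (drift `‖Δ‖ ≤ 24⟪Δ, e⟫`, e-rise ≥ 1/24 per
step), constants ×3:
* **`stackWalk_end_tiltWide_ref`** — fuel `24(H − ⟪s.1, e⟫) < N` ⇒ stopped within `N` steps at a ball with `≤ 11` contacts, `0 ≤ ⟪Δ, e⟫`, `‖Δ‖ ≤ 24⟪Δ, e⟫`;
* **`walkEnd_not_high_apart_tiltWide`** / **`walkEnd_mem_PAY_apart_tiltWide`** / **`walkEnd_not_low_apart_tiltWide`** — lateral budget `24(h + 4R₀)`, fuel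
  `24(h + 2R₀ − s.1₂) < N` resp. `24(2R₀ + s.1₂) < N`.
WHAT THIS IS NOT: not the families / count; F-C1 not moved.
-/

noncomputable section

namespace Summit.Ventures.Crystal3D.Theorems

open Finset
open Literature.MathematicalPhysics.StatisticalMechanics (barlowPos barlowStacking fccStacking constHagg basalMirror IsHaggSeq)
open Summit.Ventures.Crystal3D.Cruxes.TextureLiminf.TexShadow (stacking)
open scoped InnerProductSpace

variable {X : Finset (EuclideanSpace ℝ (Fin 3))}

/-! ## The end lemma in reference heights -/

/-- **Where the wide-tilted walk ends** (‖z − e‖ ≤ 1/3, fuel `24(H − ⟪s.1, e⟫) < N`): stopped within `N` steps at a ball of `X` with at most ELEVEN contacts,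
`0 ≤ ⟪y − s.1, e⟫`, `‖y − s.1‖ ≤ 24⟪y − s.1, e⟫`, end state satisfies `WalkInv`. -/
theorem stackWalk_end_tiltWide_ref (hX : ∀ p ∈ X, ∀ q ∈ X, p ≠ q → 1 ≤ dist p q)
    {s₀ : EuclideanSpace ℝ (Fin 3)} (hs₀ : s₀ ∈ fccSlots) (hcert : ExactOnly 0 (fccSlots.filter fun w => 0 < ⟪w, s₀⟫_ℝ))
    {z e : EuclideanSpace ℝ (Fin 3)} (hz : ‖z‖ = 1) (hze : ‖z - e‖ ≤ 1 / 3) {H : ℝ} (hH : ∀ p ∈ X, ⟪p, e⟫_ℝ ≤ H)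
    {s : EuclideanSpace ℝ (Fin 3) × List WalkEntry} (hInv : WalkInv X z s) {N : ℕ} (hN : 24 * (H - ⟪s.1, e⟫_ℝ) < N) :
    (walkRun X z N s).1 ∈ X ∧
      ((X.filter fun q => dist (walkRun X z N s).1 q = 1).card ≤ 11) ∧
      0 ≤ ⟪(walkRun X z N s).1 - s.1, e⟫_ℝ ∧
      ‖(walkRun X z N s).1 - s.1‖ ≤ 24 * ⟪(walkRun X z N s).1 - s.1, e⟫_ℝ ∧
      WalkInv X z (walkRun X z N s) ∧ walkStep X z (walkRun X z N s) = none := by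
  obtain ⟨hI, hdisp, hcount⟩ := walkRun_spec hX hs₀ hcert hz N s hInv
  have hyX : (walkRun X z N s).1 ∈ X := hI.1
  obtain ⟨hnonneg, hdrift⟩ := disp_le_of_cone_of_tilt_ref_wide hze hdisp
  have htilt := inner_ref_ge_of_tilt_wide hze ((walkRun X z N s).1 - s.1)
  -- the walk has stopped: an unstopped run would be too high in `e`
  have hstop : walkStep X z (walkRun X z N s) = none := by
    by_contra h
    have h1 := hcount h
    have h2 : ⟪(walkRun X z N s).1 - s.1, e⟫_ℝ ≤ H - ⟪s.1, e⟫_ℝ := by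
      rw [inner_sub_left]; linarith [hH _ hyX]
    -- `⟪Δ, e⟫ ≥ ⟪Δ, z⟫ − ‖Δ‖/3 ≥ ⟪Δ, z⟫/9 ≥ N/24`
    have h3 : ⟪(walkRun X z N s).1 - s.1, z⟫_ℝ / 9 ≤ ⟪(walkRun X z N s).1 - s.1, e⟫_ℝ := by nlinarith
    have h4 : ((N : ℕ) : ℝ) / 24 ≤ ⟪(walkRun X z N s).1 - s.1, e⟫_ℝ := by linarith
    linarith
  refine ⟨hyX, ?_, hnonneg, hdrift, hI, hstop⟩
  -- the stopped ball pays
  obtain ⟨-, hS, en, rest, hstk, hC⟩ := hI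
  have hstop' : walkStep X z ((walkRun X z N s).1, en :: rest) = none := by
    have : walkRun X z N s = ((walkRun X z N s).1, (walkRun X z N s).2) := rfl
    rw [this, hstk] at hstop; exact hstop
  obtain ⟨hnf, hnc⟩ := not_full_not_cap_of_walkStep_eq_none X z _ en rest hstop'
  rw [hstk] at hS
  rcases walk_dispatch hX hs₀ hcert hS.top.1 hC with h11 | hall | hc
  · exact h11
  · exact absurd hall hnf
  · exact absurd hc hnc

/-! ## Bottom families steered near `e₃`: the end is not high, and lies in the payer window -/

/-- **The end of a steered bottom-family walker whose frames are apart from the top plate is not high** (wide tilt port of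
`walkEnd_not_high_apart`): steering `z` with ‖z − e₃‖ ≤ 1/3, start at lateral radius `≤ ρ − 2 − 24(h + 4R₀)`, fuel `24(h + 2R₀ − s.1₂) < N`; then the end is in
`X`, has `≤ 11` contacts, lateral size `≤ (ρ − 2)²` and height `< h + R₀ + 2`. -/
theorem walkEnd_not_high_apart_tiltWide (hX : ∀ p ∈ X, ∀ q ∈ X, p ≠ q → 1 ≤ dist p q)
    {s₀ : EuclideanSpace ℝ (Fin 3)} (hs₀ : s₀ ∈ fccSlots) (hcert : ExactOnly 0 (fccSlots.filter fun w => 0 < ⟪w, s₀⟫_ℝ))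
    {σ₂ : ℤ → ℤ} (hσ₂ : IsHaggSeq σ₂) (L₂ : EuclideanSpace ℝ (Fin 3) ≃ₗᵢ[ℝ] EuclideanSpace ℝ (Fin 3))
    (s₂ : EuclideanSpace ℝ (Fin 3)) (R₀ h ρ : ℝ) (hρ : 2 ≤ ρ)
    (P₂ : Finset (EuclideanSpace ℝ (Fin 3))) (hP₂X : P₂ ⊆ X)
    (hcell : ∀ p ∈ X, -(2 * R₀) ≤ p 2 ∧ p 2 ≤ h + 2 * R₀ ∧ p 0 ^ 2 + p 1 ^ 2 ≤ ρ ^ 2)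
    (hP₂ : ∀ p, p ∈ P₂ ↔ (p ∈ stacking L₂ s₂ σ₂ ∧ h + R₀ ≤ p 2 ∧ p 2 ≤ h + 2 * R₀ ∧ p 0 ^ 2 + p 1 ^ 2 ≤ ρ ^ 2))
    (M₁ : Set (EuclideanSpace ℝ (Fin 3) ≃ₗᵢ[ℝ] EuclideanSpace ℝ (Fin 3))) {b : WalkEntry}
    {z : EuclideanSpace ℝ (Fin 3)} (hz : ‖z‖ = 1) (hze : ‖z - EuclideanSpace.single (2 : Fin 3) (1 : ℝ)‖ ≤ 1 / 3)
    (hM₁ : ∀ stk : List WalkEntry, StackSound z stk → StackWF z stk → stk.getLast? = some b → ∀ e ∈ stk, e.frame ∈ M₁)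
    (hapart : ∀ F ∈ M₁, F '' fccStacking 1 (Real.sqrt (2 / 3)) ≠ L₂ '' fccStacking 1 (Real.sqrt (2 / 3)) ∧
      F '' fccStacking 1 (Real.sqrt (2 / 3)) ≠
        (twinFrame L₂ (L₂ (EuclideanSpace.single (2 : Fin 3) (1 : ℝ)))) '' fccStacking 1 (Real.sqrt (2 / 3)))
    {s : EuclideanSpace ℝ (Fin 3) × List WalkEntry} (hI : WalkInv X z s) (hW : StackWF z s.2) (hlast : s.2.getLast? = some b)
    (hlat : Real.sqrt (s.1 0 ^ 2 + s.1 1 ^ 2) + 24 * (h + 4 * R₀) ≤ ρ - 2)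
    {N : ℕ} (hN : 24 * (h + 2 * R₀ - s.1 2) < N) :
    (walkRun X z N s).1 ∈ X ∧ (X.filter fun q => dist (walkRun X z N s).1 q = 1).card ≤ 11 ∧
      (walkRun X z N s).1 0 ^ 2 + (walkRun X z N s).1 1 ^ 2 ≤ (ρ - 2) ^ 2 ∧ (walkRun X z N s).1 2 < h + R₀ + 2 := by
  set e₃ : EuclideanSpace ℝ (Fin 3) := EuclideanSpace.single (2 : Fin 3) (1 : ℝ) with he₃
  have he₃i : ∀ d : EuclideanSpace ℝ (Fin 3), ⟪d, e₃⟫_ℝ = d 2 := fun d => by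
    rw [he₃, EuclideanSpace.inner_single_right]; simp
  have hH : ∀ p ∈ X, ⟪p, e₃⟫_ℝ ≤ h + 2 * R₀ := fun p hp => by rw [he₃i]; exact (hcell p hp).2.1
  have hN' : 24 * (h + 2 * R₀ - ⟪s.1, e₃⟫_ℝ) < N := by rw [he₃i]; exact hN
  obtain ⟨hyX, hydeg, hrise, hcone, -, -⟩ := stackWalk_end_tiltWide_ref hX hs₀ hcert hz hze hH hI hN'
  set y := (walkRun X z N s).1 with hy
  -- the drift bound
  have hs1X : s.1 ∈ X := hI.1
  have hrise' : ⟪y - s.1, e₃⟫_ℝ ≤ h + 4 * R₀ := by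
    rw [inner_sub_left, he₃i, he₃i]
    have h1 := (hcell y hyX).2.1; have h2 := (hcell s.1 hs1X).1
    linarith
  have hdrift : ‖y - s.1‖ ≤ 24 * (h + 4 * R₀) := hcone.trans (by nlinarith)
  -- lateral radius of the end
  have hlat_y : Real.sqrt (y 0 ^ 2 + y 1 ^ 2) ≤ ρ - 2 := by
    have h1 := sqrt_lateral_add_le s.1 (y - s.1)
    rw [add_sub_cancel] at h1
    linarith
  have hlat_y2 : y 0 ^ 2 + y 1 ^ 2 ≤ (ρ - 2) ^ 2 := by
    have h0 : 0 ≤ y 0 ^ 2 + y 1 ^ 2 := by positivity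
    have h7 := pow_le_pow_left₀ (Real.sqrt_nonneg (y 0 ^ 2 + y 1 ^ 2)) hlat_y 2
    rwa [Real.sq_sqrt h0] at h7
  -- the end state and its top frame
  obtain ⟨hIN, hWN⟩ := walkRun_valid hX hs₀ hcert hz N hI hW
  obtain ⟨en, rest, hstk, -⟩ := hIN.2.2
  have hlastN : (walkRun X z N s).2.getLast? = some b := by rw [walkRun_getLast? hX hs₀ hcert hz N _ hI, hlast]
  have heM : en.frame ∈ M₁ := hM₁ _ hIN.2.1 hWN hlastN en (by rw [hstk]; exact List.mem_cons_self)
  refine ⟨hyX, hydeg, hlat_y2, ?_⟩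
  by_contra hhigh
  push Not at hhigh
  rcases frame_image_barlow_of_walkInv_high hX hσ₂ L₂ s₂ P₂ R₀ h ρ hρ hP₂X (fun p hp => (hcell p hp).2.1) hP₂ hIN hstk hhigh
    hlat_y2 with h1 | h1
  · exact (hapart _ heM).1 h1
  · exact (hapart _ heM).2 h1

/-- **Ends of steered apart bottom-family walkers lie in the payer window** (wide tilt port of `walkEnd_mem_PAY_apart`): given `hlow`, the end is a ball of `X` with `≠ 12` contacts at height in `[−R₀ − 2, h + R₀ + 2]`. -/
theorem walkEnd_mem_PAY_apart_tiltWide (hX : ∀ p ∈ X, ∀ q ∈ X, p ≠ q → 1 ≤ dist p q)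
    {s₀ : EuclideanSpace ℝ (Fin 3)} (hs₀ : s₀ ∈ fccSlots) (hcert : ExactOnly 0 (fccSlots.filter fun w => 0 < ⟪w, s₀⟫_ℝ))
    {σ₂ : ℤ → ℤ} (hσ₂ : IsHaggSeq σ₂) (L₂ : EuclideanSpace ℝ (Fin 3) ≃ₗᵢ[ℝ] EuclideanSpace ℝ (Fin 3))
    (s₂ : EuclideanSpace ℝ (Fin 3)) (R₀ h ρ : ℝ) (hρ : 2 ≤ ρ)
    (P₂ : Finset (EuclideanSpace ℝ (Fin 3))) (hP₂X : P₂ ⊆ X)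
    (hcell : ∀ p ∈ X, -(2 * R₀) ≤ p 2 ∧ p 2 ≤ h + 2 * R₀ ∧ p 0 ^ 2 + p 1 ^ 2 ≤ ρ ^ 2)
    (hP₂ : ∀ p, p ∈ P₂ ↔ (p ∈ stacking L₂ s₂ σ₂ ∧ h + R₀ ≤ p 2 ∧ p 2 ≤ h + 2 * R₀ ∧ p 0 ^ 2 + p 1 ^ 2 ≤ ρ ^ 2))
    (M₁ : Set (EuclideanSpace ℝ (Fin 3) ≃ₗᵢ[ℝ] EuclideanSpace ℝ (Fin 3))) {b : WalkEntry}
    {z : EuclideanSpace ℝ (Fin 3)} (hz : ‖z‖ = 1) (hze : ‖z - EuclideanSpace.single (2 : Fin 3) (1 : ℝ)‖ ≤ 1 / 3)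
    (hM₁ : ∀ stk : List WalkEntry, StackSound z stk → StackWF z stk → stk.getLast? = some b → ∀ e ∈ stk, e.frame ∈ M₁)
    (hapart : ∀ F ∈ M₁, F '' fccStacking 1 (Real.sqrt (2 / 3)) ≠ L₂ '' fccStacking 1 (Real.sqrt (2 / 3)) ∧
      F '' fccStacking 1 (Real.sqrt (2 / 3)) ≠
        (twinFrame L₂ (L₂ (EuclideanSpace.single (2 : Fin 3) (1 : ℝ)))) '' fccStacking 1 (Real.sqrt (2 / 3)))
    {s : EuclideanSpace ℝ (Fin 3) × List WalkEntry} (hI : WalkInv X z s) (hW : StackWF z s.2) (hlast : s.2.getLast? = some b)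
    (hlat : Real.sqrt (s.1 0 ^ 2 + s.1 1 ^ 2) + 24 * (h + 4 * R₀) ≤ ρ - 2)
    {N : ℕ} (hN : 24 * (h + 2 * R₀ - s.1 2) < N) (hlow : -R₀ - 2 ≤ (walkRun X z N s).1 2) :
    (walkRun X z N s).1 ∈ X.filter fun y => (X.filter fun q => dist y q = 1).card ≠ 12 ∧ -R₀ - 2 ≤ y 2 ∧ y 2 ≤ h + R₀ + 2 := by
  obtain ⟨hyX, hydeg, -, hhigh⟩ := walkEnd_not_high_apart_tiltWide hX hs₀ hcert hσ₂ L₂ s₂ R₀ h ρ hρ P₂ hP₂X hcell hP₂ M₁ hz hze hM₁ hapart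
    hI hW hlast hlat hN
  rw [Finset.mem_filter]
  exact ⟨hyX, by omega, hlow, by linarith⟩

/-! ## Top families steered near `−e₃`: the end is not low -/

/-- **The end of a steered top-family walker whose frames are apart from the bottom plate is not low** (wide tilt port of `walkEnd_not_low_apart`):
steering `z` with ‖z + e₃‖ ≤ 1/3, fuel `24(2R₀ + s.1₂) < N`; end in `X`, `≤ 11` contacts, lateral size `≤ (ρ − 2)²`, height `> −R₀ − 2`. -/
theorem walkEnd_not_low_apart_tiltWide (hX : ∀ p ∈ X, ∀ q ∈ X, p ≠ q → 1 ≤ dist p q)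
    {sE : EuclideanSpace ℝ (Fin 3)} (hsE : sE ∈ fccSlots) (hcert : ExactOnly 0 (fccSlots.filter fun w => 0 < ⟪w, sE⟫_ℝ))
    {σ₁ : ℤ → ℤ} (hσ₁ : IsHaggSeq σ₁) (L₁ : EuclideanSpace ℝ (Fin 3) ≃ₗᵢ[ℝ] EuclideanSpace ℝ (Fin 3))
    (s₀ : EuclideanSpace ℝ (Fin 3)) (R₀ h ρ : ℝ) (hρ : 2 ≤ ρ)
    (P₁ : Finset (EuclideanSpace ℝ (Fin 3))) (hP₁X : P₁ ⊆ X)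
    (hcell : ∀ p ∈ X, -(2 * R₀) ≤ p 2 ∧ p 2 ≤ h + 2 * R₀ ∧ p 0 ^ 2 + p 1 ^ 2 ≤ ρ ^ 2)
    (hP₁ : ∀ p, p ∈ P₁ ↔ (p ∈ stacking L₁ s₀ σ₁ ∧ -(2 * R₀) ≤ p 2 ∧ p 2 ≤ -R₀ ∧ p 0 ^ 2 + p 1 ^ 2 ≤ ρ ^ 2))
    (M₂ : Set (EuclideanSpace ℝ (Fin 3) ≃ₗᵢ[ℝ] EuclideanSpace ℝ (Fin 3))) {b : WalkEntry}
    {z : EuclideanSpace ℝ (Fin 3)} (hz : ‖z‖ = 1) (hze : ‖z - (-EuclideanSpace.single (2 : Fin 3) (1 : ℝ))‖ ≤ 1 / 3)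
    (hM₂ : ∀ stk : List WalkEntry, StackSound z stk → StackWF z stk → stk.getLast? = some b → ∀ e ∈ stk, e.frame ∈ M₂)
    (hapart : ∀ F ∈ M₂, F '' fccStacking 1 (Real.sqrt (2 / 3)) ≠ L₁ '' fccStacking 1 (Real.sqrt (2 / 3)) ∧
      F '' fccStacking 1 (Real.sqrt (2 / 3)) ≠
        (twinFrame L₁ (L₁ (EuclideanSpace.single (2 : Fin 3) (1 : ℝ)))) '' fccStacking 1 (Real.sqrt (2 / 3)))
    {s : EuclideanSpace ℝ (Fin 3) × List WalkEntry} (hI : WalkInv X z s) (hW : StackWF z s.2) (hlast : s.2.getLast? = some b)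
    (hlat : Real.sqrt (s.1 0 ^ 2 + s.1 1 ^ 2) + 24 * (h + 4 * R₀) ≤ ρ - 2)
    {N : ℕ} (hN : 24 * (2 * R₀ + s.1 2) < N) :
    (walkRun X z N s).1 ∈ X ∧ (X.filter fun q => dist (walkRun X z N s).1 q = 1).card ≤ 11 ∧
      (walkRun X z N s).1 0 ^ 2 + (walkRun X z N s).1 1 ^ 2 ≤ (ρ - 2) ^ 2 ∧ -R₀ - 2 < (walkRun X z N s).1 2 := by
  set zt : EuclideanSpace ℝ (Fin 3) := -EuclideanSpace.single (2 : Fin 3) (1 : ℝ) with hzt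
  have hzti : ∀ d : EuclideanSpace ℝ (Fin 3), ⟪d, zt⟫_ℝ = -d 2 := fun d => by
    rw [hzt, inner_neg_right, EuclideanSpace.inner_single_right]; simp
  have hH : ∀ p ∈ X, ⟪p, zt⟫_ℝ ≤ 2 * R₀ := fun p hp => by rw [hzti]; linarith [(hcell p hp).1]
  have hN' : 24 * (2 * R₀ - ⟪s.1, zt⟫_ℝ) < N := by rw [hzti]; linarith
  obtain ⟨hyX, hydeg, hrise, hcone, -, -⟩ := stackWalk_end_tiltWide_ref hX hsE hcert hz hze hH hI hN'
  set y := (walkRun X z N s).1 with hy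
  have hs1X : s.1 ∈ X := hI.1
  have hrise' : ⟪y - s.1, zt⟫_ℝ ≤ h + 4 * R₀ := by
    rw [inner_sub_left, hzti, hzti]
    have h1 := (hcell y hyX).1; have h2 := (hcell s.1 hs1X).2.1
    linarith
  have hdrift : ‖y - s.1‖ ≤ 24 * (h + 4 * R₀) := hcone.trans (by nlinarith)
  have hlat_y : Real.sqrt (y 0 ^ 2 + y 1 ^ 2) ≤ ρ - 2 := by
    have h1 := sqrt_lateral_add_le s.1 (y - s.1)
    rw [add_sub_cancel] at h1
    linarith
  have hlat_y2 : y 0 ^ 2 + y 1 ^ 2 ≤ (ρ - 2) ^ 2 := by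
    have h0 : 0 ≤ y 0 ^ 2 + y 1 ^ 2 := by positivity
    have h7 := pow_le_pow_left₀ (Real.sqrt_nonneg (y 0 ^ 2 + y 1 ^ 2)) hlat_y 2
    rwa [Real.sq_sqrt h0] at h7
  obtain ⟨hIN, hWN⟩ := walkRun_valid hX hsE hcert hz N hI hW
  obtain ⟨en, rest, hstk, -⟩ := hIN.2.2
  have hlastN : (walkRun X z N s).2.getLast? = some b := by rw [walkRun_getLast? hX hsE hcert hz N _ hI, hlast]
  have heM : en.frame ∈ M₂ := hM₂ _ hIN.2.1 hWN hlastN en (by rw [hstk]; exact List.mem_cons_self)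
  refine ⟨hyX, hydeg, hlat_y2, ?_⟩
  by_contra hlow
  push Not at hlow
  rcases frame_image_barlow_of_walkInv_low hX hσ₁ L₁ s₀ P₁ R₀ ρ hρ hP₁X (fun p hp => (hcell p hp).1) hP₁ hIN hstk hlow
    hlat_y2 with h1 | h1
  · exact (hapart _ heM).1 h1
  · exact (hapart _ heM).2 h1

end Summit.Ventures.Crystal3D.Theorems

end
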